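import Literature.Computability.Cryptography.PeriodisedFourierWindows
import Literature.Computability.Cryptography.VanDamSeroussiTransform
import HarnessLib

/-!
# The van Dam–Seroussi branch state after the transform and the un-phasing

Topic `Literature/Computability/Cryptography`; support for the discharge of
`VanDamSeroussi2002_gaussSumPhase_qsolvable` (van Dam–Seroussi 2002, §4 Algorithm 1 / Thm. 1),
sequel of `VanDamSeroussiTransform.lean` (the character state `|χ⟩` through Hales's periodised
transform lands, up to the periodisation error, on `w p^{-1/2} G(χ, e) · Σ_i χ⁻¹(i) bump_i`) and of
`PeriodisedFourierWindows.lean` (the division step `y ↦ (kOf y, rOff)`; at most one bump is alive at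
each `y`, `Hales2002.target_eq`). Algorithm 1 continues with a phase change on the residue register;
in the tree's circuit the register holding `k = kOf y` is multiplied by `χ(k)` (for a unit `k`; the
oracle answers `0` at `k = 0`), digit by digit. This file proves what that does:

* `Hales2002.sum_range_mul_eq_sum_sum` (`Σ_{k<Rp} F(k) = Σ_{j<R} Σ_{x<p} F(x + jp)`),
  **`Hales2002.sum_norm_sq_sum_repFT`** — Parseval for superpositions of the repeated states:
  `Σ_{y<Q} |Σ_x d_x (F_Q rep_R x)(y)|² = Σ_x |d_x|²` (the transformed repeated states are
  orthonormal), `norm_toE_sum_repFT`;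
* `Hales2002.sum_mul_bump_eq` — `Σ_i f(i) bump_i(y)` has the single live term `i = kOf y`
  (generalising `target_eq`); `Hales2002.norm_toE_mul_le` (pointwise multipliers of modulus `≤ δ`);
* `VanDamSeroussi.unphase χ k = [k = 0] + [k ≠ 0] χ(k)`, `VanDamSeroussi.commonAmp` — the amplitude
  `[offset alive][k ≠ 0] · peak_0(offset)` left after un-phasing, THE SAME FOR EVERY CHARACTER, and
  **`unphase_mul_sum_inv_bump`**: `unphase(kOf y) · Σ_i χ⁻¹(i) bump_i(y) = commonAmp(y)`;
* **`norm_toE_branch_sub_le`** — the branch state of Algorithm 1 in the tree's realisation: for input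
  coefficients `c_x` (the imprinted phases, `≈ χ(x)·w`), the periodised transform, and an un-phasing
  multiplier `m₁ ≈ unphase(kOf ·)` of modulus `≤ 1`, the resulting vector is within
  `√(Σ|c_x − χ(x)w|²) + (p−1)|w| ε_F + δ₁ (√(p−1)|w| + (p−1)|w| ε_F)`, `ε_F = √p(πRp/Q + 2/√R)`, of
  `(w p^{-1/2} G(χ, e)) · commonAmp` — a CHARACTER-INDEPENDENT vector times the normalised Gauss sum:
  the two branches of the interference (χ and the quadratic reference) differ only by the phases
  `G(χ_s, e)/√p` [VanDamSeroussi2002, §4 proof of Thm. 1].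

Everything is proved; the two definitions have bodies; no named fact.

## References

* W. van Dam, G. Seroussi, *Efficient quantum algorithms for estimating Gauss sums*,
  arXiv:quant-ph/0207131 (2002), §4 (Algorithm 1: `F|χ⟩ = (G/√p)|χ⁻¹⟩`, then the phase change;
  Thm. 1: interference against a known Gauss sum) [VanDamSeroussi2002].
* L. Hales, PhD thesis, UC Berkeley 2002 (arXiv:quant-ph/0212002), Ch. 5 §1 Algorithm 3, Ch. 9 §2
  Thm. 10 [Hales2002].
-/

noncomputable section

open Finset Real Complex

namespace Literature.Computability.Cryptography

namespace Hales2002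

/-! ### Parseval for superpositions of repeated states -/

/-- `Σ_{k<Rp} F(k) = Σ_{j<R} Σ_{x<p} F(x + jp)`. [folklore] -/
theorem sum_range_mul_eq_sum_sum {M : Type*} [AddCommMonoid M] (F : ℕ → M) (R p : ℕ) :
    ∑ k ∈ range (R * p), F k = ∑ j ∈ range R, ∑ x ∈ range p, F (x + j * p) := by
  induction R with
  | zero => simp
  | succ R ih =>
    rw [Nat.succ_mul, Finset.sum_range_add, ih, Finset.sum_range_succ]
    congr 1
    exact Finset.sum_congr rfl fun x _ => by rw [add_comm]

/-- **Parseval for superpositions of the repeated states**: for coefficients `d` on `x < p`,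
`Σ_{y<Q} |Σ_{x<p} d_x · (F_Q rep_R x)(y)|² = Σ_{x<p} |d_x|²` — the transformed repeated states
`F_Q (R^{-1/2} Σ_j |x + jp⟩)`, `x < p`, are orthonormal (`Rp ≤ Q`). [cite: Hales2002, Ch. 5 §1 Algorithm 3 (F_M is unitary; the repeated states are orthonormal)] -/
theorem sum_norm_sq_sum_repFT {p R Q : ℕ} (hp : 0 < p) (hR : 0 < R) (hRQ : R * p ≤ Q) (d : ℕ → ℂ) :
    ∑ y ∈ range Q, ‖∑ x ∈ range p, d x * repFT p R Q x y‖ ^ 2 = ∑ x ∈ range p, ‖d x‖ ^ 2 := by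
  have hQ : 0 < Q := lt_of_lt_of_le (Nat.mul_pos hR hp) hRQ
  have hRQr : (0 : ℝ) < (R : ℝ) * Q := by exact_mod_cast Nat.mul_pos hR hQ
  set c : ℝ := (Real.sqrt ((R : ℝ) * Q))⁻¹ with hc
  have hc2 : c ^ 2 = ((R : ℝ) * Q)⁻¹ := by rw [hc, inv_pow, Real.sq_sqrt hRQr.le]
  -- the superposition as a character sum over `k < Rp` with coefficients `c · d (k mod p)`
  set a : ℕ → ℂ := fun k => (c : ℂ) * d (k % p) with ha
  have hmod : ∀ x ∈ range p, ∀ j, (x + j * p) % p = x := fun x hx j => by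
    rw [Nat.add_mul_mod_self_right, Nat.mod_eq_of_lt (mem_range.1 hx)]
  have hrep : ∀ y, ∑ x ∈ range p, d x * repFT p R Q x y = ∑ k ∈ range (R * p), a k * e ((k : ℝ) * y / Q) := by
    intro y
    rw [sum_range_mul_eq_sum_sum]
    have h1 : ∀ x ∈ range p, d x * repFT p R Q x y = ∑ j ∈ range R, (c : ℂ) * d x * e (((x + j * p : ℕ) : ℝ) * y / Q) := by
      intro x _
      rw [repFT, ← hc, Finset.mul_sum, Finset.mul_sum]
      exact Finset.sum_congr rfl fun j _ => by ring
    rw [Finset.sum_congr rfl h1, Finset.sum_comm]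
    refine Finset.sum_congr rfl fun j _ => Finset.sum_congr rfl fun x hx => ?_
    rw [ha]
    dsimp only
    rw [hmod x hx j]
  simp_rw [hrep]
  rw [parseval_range hQ hRQ a, sum_range_mul_eq_sum_sum]
  have h2 : ∀ j ∈ range R, ∑ x ∈ range p, ‖a (x + j * p)‖ ^ 2 = c ^ 2 * ∑ x ∈ range p, ‖d x‖ ^ 2 := by
    intro j _
    rw [Finset.mul_sum]
    refine Finset.sum_congr rfl fun x hx => ?_
    rw [ha]
    dsimp only
    rw [hmod x hx j, norm_mul, mul_pow, Complex.norm_real, Real.norm_eq_abs, sq_abs]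
  rw [Finset.sum_congr rfl h2, Finset.sum_const, Finset.card_range, nsmul_eq_mul, hc2]
  field_simp

/-- The same as a norm in `ℂ^Q`: `‖Σ_x d_x F_Q rep_R x‖ = √(Σ_x |d_x|²)`. [cite: Hales2002, Ch. 5 §1 Algorithm 3] -/
theorem norm_toE_sum_repFT {p R Q : ℕ} (hp : 0 < p) (hR : 0 < R) (hRQ : R * p ≤ Q) (d : ℕ → ℂ) :
    ‖toE Q (fun y => ∑ x ∈ range p, d x * repFT p R Q x y)‖ = Real.sqrt (∑ x ∈ range p, ‖d x‖ ^ 2) := by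
  rw [norm_toE, sum_norm_sq_sum_repFT hp hR hRQ]

/-! ### One live bump, and pointwise multipliers -/

/-- **At most one bump is alive at each point** (the windows are disjoint): for every `f`,
`Σ_{i<p} f(i) bump_i(y) = [offset alive] · f(kOf y) · peak_0(offset)`, `offset = rOff (kOf y) y`.
[cite: Hales2002, Ch. 9 §2 ("the |b_i⟩ have disjoint supports")] -/
theorem sum_mul_bump_eq {p R Q y : ℕ} (hp : 0 < p) (hpQ : p ≤ Q) (f : ℕ → ℂ) :
    ∑ i ∈ range p, f i * bump p R Q i y =
      if rOff p Q (kOf p Q y) y ∈ tail p Q then 0 else f (kOf p Q y) * peak p R Q 0 (rOff p Q (kOf p Q y) y) := by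
  have hk : kOf p Q y < p := kOf_lt hp Q y
  rw [Finset.sum_eq_single (kOf p Q y)]
  · simp only [bump]
    split_ifs with h
    · rw [mul_zero]
    · rw [speak_eq_peak_zero_rOff hp hk hpQ]
  · intro i hi hne
    simp only [bump]
    split_ifs with h
    · rw [mul_zero]
    · exact absurd (kOf_eq_of_not_mem_tail hp hpQ (mem_range.1 hi) h).symm hne
  · intro h; exact absurd (mem_range.2 hk) h

/-- **Pointwise multipliers**: if `|m(y)| ≤ δ` for `y < Q` then `‖m · f‖ ≤ δ ‖f‖` in `ℂ^Q`. [folklore] -/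
theorem norm_toE_mul_le {Q : ℕ} (m f : ℕ → ℂ) {δ : ℝ} (hδ : 0 ≤ δ) (hm : ∀ y, y < Q → ‖m y‖ ≤ δ) :
    ‖toE Q (fun y => m y * f y)‖ ≤ δ * ‖toE Q f‖ := by
  rw [norm_toE, norm_toE]
  calc Real.sqrt (∑ y ∈ range Q, ‖m y * f y‖ ^ 2) ≤ Real.sqrt (∑ y ∈ range Q, (δ * ‖f y‖) ^ 2) := by
        refine Real.sqrt_le_sqrt (Finset.sum_le_sum fun y hy => ?_)
        rw [norm_mul]
        exact pow_le_pow_left₀ (by positivity) (mul_le_mul_of_nonneg_right (hm y (mem_range.1 hy)) (norm_nonneg _)) 2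
    _ = δ * Real.sqrt (∑ y ∈ range Q, ‖f y‖ ^ 2) := by
        rw [show ∑ y ∈ range Q, (δ * ‖f y‖) ^ 2 = δ ^ 2 * ∑ y ∈ range Q, ‖f y‖ ^ 2 by
          rw [Finset.mul_sum]; exact Finset.sum_congr rfl fun y _ => by ring,
          Real.sqrt_mul (sq_nonneg δ), Real.sqrt_sq hδ]

/-- `toE` of a pointwise product distributes over differences. [folklore] -/
theorem toE_mul_sub {Q : ℕ} (m f g : ℕ → ℂ) :
    toE Q (fun y => m y * f y) - toE Q (fun y => m y * g y) = toE Q (fun y => m y * (f y - g y)) := by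
  rw [← toE_sub]
  exact congrArg (toE Q) (funext fun y => by ring)

end Hales2002

namespace VanDamSeroussi

open Hales2002

variable {p : ℕ} [hp : Fact p.Prime]

/-! ### The un-phasing multiplier and the common amplitude -/

/-- **The ideal un-phasing multiplier** on the residue `k`: `χ(k)` for a unit, `1` at `k = 0` (where the
oracle of the circuit answers `0`, i.e. no phase). [cite: VanDamSeroussi2002, §4 Algorithm 1 (the phase change on the Fourier-transformed character state)] -/
def unphase (χ : MulChar (ZMod p) ℂ) (k : ℕ) : ℂ := if k = 0 then 1 else χ (k : ZMod p)

/-- The un-phasing multiplier has modulus one (`k < p`). [folklore] -/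
theorem norm_unphase (χ : MulChar (ZMod p) ℂ) {k : ℕ} (hk : k < p) : ‖unphase χ k‖ = 1 := by
  unfold unphase
  split_ifs with h
  · exact norm_one
  · refine norm_mulChar_apply_of_isUnit χ ?_
    rw [isUnit_iff_ne_zero, Ne, ZMod.natCast_eq_zero_iff]
    exact fun hd => absurd (Nat.le_of_dvd (Nat.pos_of_ne_zero h) hd) (not_le.2 hk)

/-- `unphase(k) · χ⁻¹(k) = [k ≠ 0]` (`k < p`). [folklore] -/
theorem unphase_mul_inv (χ : MulChar (ZMod p) ℂ) {k : ℕ} (hk : k < p) :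
    unphase χ k * χ⁻¹ (k : ZMod p) = if k = 0 then 0 else 1 := by
  unfold unphase
  split_ifs with h
  · rw [h, Nat.cast_zero, MulChar.map_zero, mul_zero]
  · have hu : IsUnit (k : ZMod p) := by
      rw [isUnit_iff_ne_zero, Ne, ZMod.natCast_eq_zero_iff]
      exact fun hd => absurd (Nat.le_of_dvd (Nat.pos_of_ne_zero h) hd) (not_le.2 hk)
    have hne : χ (k : ZMod p) ≠ 0 := fun h0 => by
      have := norm_mulChar_apply_of_isUnit χ hu
      rw [h0, norm_zero] at this
      exact zero_ne_one this
    rw [MulChar.inv_apply_eq_inv', mul_inv_cancel₀ hne]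

/-- **The common amplitude** after the division step and the un-phasing: the fixed bump read at the
offset, alive when the offset is in its window and the residue is a unit — independent of the
character. [cite: VanDamSeroussi2002, §4 proof of Thm. 1 (both branches return to the same state up to the phase e^{iγ})] -/
def commonAmp (p R Q y : ℕ) : ℂ :=
  if rOff p Q (kOf p Q y) y ∈ tail p Q ∨ kOf p Q y = 0 then 0 else peak p R Q 0 (rOff p Q (kOf p Q y) y)

/-- The common amplitude is bounded by the bump. [folklore] -/
theorem norm_commonAmp_le (p R Q y : ℕ) : ‖commonAmp p R Q y‖ ≤ ‖peak p R Q 0 (rOff p Q (kOf p Q y) y)‖ := by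
  unfold commonAmp
  split_ifs
  · rw [norm_zero]; exact norm_nonneg _
  · exact le_rfl

/-- **Un-phasing the transformed character state gives the common amplitude**:
`unphase(kOf y) · Σ_{i<p} χ⁻¹(i) bump_i(y) = commonAmp(y)`. [cite: VanDamSeroussi2002, §4 Algorithm 1 and proof of Thm. 1] -/
theorem unphase_mul_sum_inv_bump (χ : MulChar (ZMod p) ℂ) {R Q : ℕ} (hpQ : p ≤ Q) (y : ℕ) :
    unphase χ (kOf p Q y) * ∑ i ∈ range p, χ⁻¹ (i : ZMod p) * bump p R Q i y = commonAmp p R Q y := by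
  have hp0 : 0 < p := hp.out.pos
  have hk : kOf p Q y < p := kOf_lt hp0 Q y
  rw [sum_mul_bump_eq hp0 hpQ, commonAmp]
  by_cases ht : rOff p Q (kOf p Q y) y ∈ tail p Q
  · rw [if_pos ht, if_pos (Or.inl ht), mul_zero]
  · rw [if_neg ht, ← mul_assoc, unphase_mul_inv χ hk]
    by_cases h0 : kOf p Q y = 0
    · rw [if_pos h0, if_pos (Or.inr h0), zero_mul]
    · rw [if_neg h0, if_neg (not_or.2 ⟨ht, h0⟩), one_mul]

/-! ### The branch state -/

/-- The periodisation error `ε_F = √p (πRp/Q + 2/√R)`. [cite: Hales2002, Ch. 9 §2 Thm. 10] -/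
def epsF (p R Q : ℕ) : ℝ := Real.sqrt p * (π * R * p / Q + 2 / Real.sqrt R)

/-- `ε_F ≥ 0`. [folklore] -/
theorem epsF_nonneg (p R Q : ℕ) : 0 ≤ epsF p R Q := by unfold epsF; positivity

/-- **The ideal branch state**: with exact phases `χ(x) w` in and `unphase(kOf ·)` out, the vector after
transform and un-phasing is within `(p−1)|w| ε_F` of `(w p^{-1/2} G(χ, e)) · commonAmp`.
[cite: VanDamSeroussi2002, §4 Algorithm 1] [cite: Hales2002, Ch. 9 §2 Thm. 10] -/
theorem norm_toE_unphase_transform_sub_le {χ : MulChar (ZMod p) ℂ} (hχ : χ ≠ 1) {R Q : ℕ} (hR : 0 < R)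
    (hRQ : R * p ≤ Q) (hpQ : 4 * p ≤ Q) (w : ℂ) :
    ‖toE Q (fun y => unphase χ (kOf p Q y) * ∑ x ∈ range p, χ (x : ZMod p) * w * repFT p R Q x y) -
        toE Q (fun y => w * ((((Real.sqrt p)⁻¹ : ℝ) : ℂ) * gaussSum χ ZMod.stdAddChar) * commonAmp p R Q y)‖ ≤
      ((p : ℝ) - 1) * ‖w‖ * epsF p R Q := by
  have hp0 : 0 < p := hp.out.pos
  have hpQ' : p ≤ Q := by omega
  have hcom : (fun y => w * ((((Real.sqrt p)⁻¹ : ℝ) : ℂ) * gaussSum χ ZMod.stdAddChar) * commonAmp p R Q y) =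
      fun y => unphase χ (kOf p Q y) * (w * ((((Real.sqrt p)⁻¹ : ℝ) : ℂ) * gaussSum χ ZMod.stdAddChar) *
        ∑ i ∈ range p, χ⁻¹ (i : ZMod p) * bump p R Q i y) := by
    funext y
    rw [← unphase_mul_sum_inv_bump χ hpQ' y]
    ring
  rw [hcom, toE_mul_sub]
  refine (norm_toE_mul_le _ _ zero_le_one fun y hy => (norm_unphase χ (kOf_lt hp0 Q y)).le).trans ?_
  rw [one_mul, toE_sub]
  have h := norm_toE_transform_mulChar_sub_le hχ hR hRQ hpQ w
  rw [sum_range_norm_mulChar] at h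
  exact h

/-- **The branch state of the tree's realisation of Algorithm 1.** Input coefficients `c` (the phases
actually imprinted, times the normalisation; `c ≈ χ · w`), the periodised transform of length `Q` with
`R` repetitions, and an un-phasing multiplier `m₁` of modulus `≤ 1` with `m₁(y) ≈ unphase(kOf y)`:
the resulting vector is within
`√(Σ_x |c_x − χ(x)w|²) + (p−1)|w| ε_F + δ₁ (√(p−1)|w| + (p−1)|w| ε_F)`
of `(w p^{-1/2} G(χ, e)) · commonAmp` — the character enters only through the normalised Gauss sum.
[cite: VanDamSeroussi2002, §4 Algorithm 1 and proof of Thm. 1] [cite: Hales2002, Ch. 9 §2 Thm. 10] -/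
theorem norm_toE_branch_sub_le {χ : MulChar (ZMod p) ℂ} (hχ : χ ≠ 1) {R Q : ℕ} (hR : 0 < R)
    (hRQ : R * p ≤ Q) (hpQ : 4 * p ≤ Q) (w : ℂ) (c m₁ : ℕ → ℂ) {δ₁ : ℝ} (hδ₁ : 0 ≤ δ₁)
    (hm₁ : ∀ y, y < Q → ‖m₁ y‖ ≤ 1) (hm₁' : ∀ y, y < Q → ‖m₁ y - unphase χ (kOf p Q y)‖ ≤ δ₁) :
    ‖toE Q (fun y => m₁ y * ∑ x ∈ range p, c x * repFT p R Q x y) -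
        toE Q (fun y => w * ((((Real.sqrt p)⁻¹ : ℝ) : ℂ) * gaussSum χ ZMod.stdAddChar) * commonAmp p R Q y)‖ ≤
      Real.sqrt (∑ x ∈ range p, ‖c x - χ (x : ZMod p) * w‖ ^ 2) + ((p : ℝ) - 1) * ‖w‖ * epsF p R Q +
        δ₁ * (Real.sqrt ((p : ℝ) - 1) * ‖w‖ + ((p : ℝ) - 1) * ‖w‖ * epsF p R Q) := by
  have hp0 : 0 < p := hp.out.pos
  have hp1 : 1 ≤ p := hp0
  have hpQ' : p ≤ Q := by omega
  -- the three vectors: actual input `A_c`, ideal input `A_χ`, target `T`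
  set G : ℂ := w * ((((Real.sqrt p)⁻¹ : ℝ) : ℂ) * gaussSum χ ZMod.stdAddChar) with hG
  set Ac : ℕ → ℂ := fun y => ∑ x ∈ range p, c x * repFT p R Q x y with hAc
  set Aχ : ℕ → ℂ := fun y => ∑ x ∈ range p, χ (x : ZMod p) * w * repFT p R Q x y with hAχ
  set T : ℕ → ℂ := fun y => G * ∑ i ∈ range p, χ⁻¹ (i : ZMod p) * bump p R Q i y with hT
  set u : ℕ → ℂ := fun y => unphase χ (kOf p Q y) with hu
  -- `u · T = G · commonAmp`
  have hcom : (fun y => G * commonAmp p R Q y) = fun y => u y * T y := by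
    funext y
    simp only [hu, hT]
    rw [← unphase_mul_sum_inv_bump χ hpQ' y]
    ring
  -- (1) actual input against ideal input, through the transform (an isometry on these vectors)
  have h1 : ‖toE Q (fun y => m₁ y * Ac y) - toE Q (fun y => m₁ y * Aχ y)‖ ≤
      Real.sqrt (∑ x ∈ range p, ‖c x - χ (x : ZMod p) * w‖ ^ 2) := by
    rw [toE_mul_sub]
    refine (norm_toE_mul_le _ _ zero_le_one hm₁).trans ?_
    rw [one_mul]
    have hdiff : (fun y => Ac y - Aχ y) = fun y => ∑ x ∈ range p, (c x - χ (x : ZMod p) * w) * repFT p R Q x y := by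
      funext y
      simp only [hAc, hAχ]
      rw [← Finset.sum_sub_distrib]
      exact Finset.sum_congr rfl fun x _ => by ring
    rw [hdiff, norm_toE_sum_repFT hp0 hR hRQ]
  -- (2) ideal input against the target
  have h2 : ‖toE Q (fun y => m₁ y * Aχ y) - toE Q (fun y => m₁ y * T y)‖ ≤ ((p : ℝ) - 1) * ‖w‖ * epsF p R Q := by
    rw [toE_mul_sub]
    refine (norm_toE_mul_le _ _ zero_le_one hm₁).trans ?_
    rw [one_mul, toE_sub]
    have h := norm_toE_transform_mulChar_sub_le hχ hR hRQ hpQ w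
    rw [sum_range_norm_mulChar] at h
    exact h
  -- (3) the un-phasing multiplier against the ideal one, on the target
  have hT_norm : ‖toE Q T‖ ≤ Real.sqrt ((p : ℝ) - 1) * ‖w‖ + ((p : ℝ) - 1) * ‖w‖ * epsF p R Q := by
    have hA : ‖toE Q Aχ‖ = Real.sqrt ((p : ℝ) - 1) * ‖w‖ := by
      simp only [hAχ]
      rw [norm_toE_sum_repFT hp0 hR hRQ (fun x => χ (x : ZMod p) * w)]
      have hs : ∑ x ∈ range p, ‖χ (x : ZMod p) * w‖ ^ 2 = ((p : ℝ) - 1) * ‖w‖ ^ 2 := by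
        have h1' : ∀ x ∈ range p, ‖χ (x : ZMod p) * w‖ ^ 2 = ‖χ (x : ZMod p)‖ * ‖w‖ ^ 2 := by
          intro x hx
          rw [norm_mul, mul_pow]
          congr 1
          -- `‖χ x‖ ∈ {0, 1}`, so `‖χ x‖² = ‖χ x‖`
          by_cases hux : IsUnit (x : ZMod p)
          · rw [norm_mulChar_apply_of_isUnit χ hux, one_pow]
          · rw [MulChar.map_nonunit χ hux, norm_zero]; ring
        rw [Finset.sum_congr rfl h1', ← Finset.sum_mul, sum_range_norm_mulChar]
      rw [hs, Real.sqrt_mul' _ (sq_nonneg _), Real.sqrt_sq (norm_nonneg _)]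
    have hAT : ‖toE Q Aχ - toE Q T‖ ≤ ((p : ℝ) - 1) * ‖w‖ * epsF p R Q := by
      rw [← toE_sub]
      have h := norm_toE_transform_mulChar_sub_le hχ hR hRQ hpQ w
      rw [sum_range_norm_mulChar, ← toE_sub] at h
      exact h
    calc ‖toE Q T‖ = ‖toE Q Aχ - (toE Q Aχ - toE Q T)‖ := by rw [sub_sub_cancel]
      _ ≤ ‖toE Q Aχ‖ + ‖toE Q Aχ - toE Q T‖ := norm_sub_le _ _
      _ ≤ _ := by rw [hA]; exact add_le_add le_rfl hAT
  have h3 : ‖toE Q (fun y => m₁ y * T y) - toE Q (fun y => u y * T y)‖ ≤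
      δ₁ * (Real.sqrt ((p : ℝ) - 1) * ‖w‖ + ((p : ℝ) - 1) * ‖w‖ * epsF p R Q) := by
    have e : toE Q (fun y => m₁ y * T y) - toE Q (fun y => u y * T y) = toE Q (fun y => (m₁ y - u y) * T y) := by
      rw [← toE_sub]
      exact congrArg (toE Q) (funext fun y => by ring)
    rw [e]
    exact (norm_toE_mul_le _ _ hδ₁ fun y hy => hm₁' y hy).trans (mul_le_mul_of_nonneg_left hT_norm hδ₁)
  -- assemble
  rw [hcom]
  calc ‖toE Q (fun y => m₁ y * Ac y) - toE Q (fun y => u y * T y)‖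
      = ‖(toE Q (fun y => m₁ y * Ac y) - toE Q (fun y => m₁ y * Aχ y)) +
          ((toE Q (fun y => m₁ y * Aχ y) - toE Q (fun y => m₁ y * T y)) +
            (toE Q (fun y => m₁ y * T y) - toE Q (fun y => u y * T y)))‖ := by
        rw [sub_add_sub_cancel, sub_add_sub_cancel]
    _ ≤ ‖toE Q (fun y => m₁ y * Ac y) - toE Q (fun y => m₁ y * Aχ y)‖ +
          (‖toE Q (fun y => m₁ y * Aχ y) - toE Q (fun y => m₁ y * T y)‖ +
            ‖toE Q (fun y => m₁ y * T y) - toE Q (fun y => u y * T y)‖) :=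
        (norm_add_le _ _).trans (add_le_add le_rfl (norm_add_le _ _))
    _ ≤ _ := by rw [← add_assoc]; exact add_le_add (add_le_add h1 h2) h3

end VanDamSeroussi

end Literature.Computability.Cryptography

end
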